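import Summits.ResolutionOfSingularities.ResolutionOfSingularities.Theorems.WeightedInvariantHypersurfaceAdmissibleSequences
import Summits.ResolutionOfSingularities.ResolutionOfSingularities.Theorems.WeightedInvariantDefs
import Summits.ResolutionOfSingularities.ResolutionOfSingularities.Theorems.WeightedInvariantWeightedThesisHypersurfaceChoiceDim
import Literature.AlgebraicGeometry.Resolution.MarkedIdeals
import HarnessLib

/-!
# Stages of an e = 1 admissible sequence — the data model and the invariant of rung `e = 1` of the door

Route `ResolutionOfSingularities/WeightedInvariant`, door crux `HypersurfaceCentreConstruction`
(stmt-ResolutionOfSingularities-19897), e-ladder of `res-L1-w43-stub-10` (cell res-hironaka,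
`D/res-D-pv-025/DOOR-ELADDER-PLAN.md`, skeleton `D/res-D-pv-025/E1Skeleton.lean` sha16 `ed471ca5092430d4`:
the rung `AdmissiblyResolvableDim p 1` is a kernel-checked composition of three stubs over these definitions,
modulo the vendored Abramovich–Quek–Schober facts of `Literature/…/HypersurfaceHeightTwoWeightedCentre.lean`).
DEFINITIONS ONLY (objects of the line; nothing is asserted):

* `ELadderOne.Stage k` — a stage of an e = 1 sequence = the cobordant tower's own presentation data:
  `f : Y → Spec k` smooth separated quasi-compact, `i : X ⟶ Y` a closed immersion from an integral scheme with
  locally principal kernel (the hypersurface pair `(Y, ker i)`, `Stage.toPair`), a torus-quotient presentation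
  `q : X ⟶ V` over `k` and a graded atlas `GradedAtlas j f i q` (`Theorems/WeightedInvariantDefs.lean`); the
  successor stage is produced by the tree (`DatumToEmbedded.quotientStep_of_isRegularWeightedCentre`);
* `Stage.maxSing` — the maximal points (generic points of the irreducible components) of the image
  `singImage (ker i)` of the non-regular locus; `Stage.mu` — the largest order of `ker i` at such a point (`ℕ∞`),
  the termination measure of rung 1 (Abramovich–Quek–Schober: the ORDER drops);
* `Stage.Inv` — the induction invariant: (I1) at every maximal point of `singImage` the ambient local ring is
  regular of dimension `2` (transversal dimension 2: the AQS fact applies); (I2) on every chart of the atlas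
  through such a point its prime is homogeneous with GRADED-SIMPLE quotient (the chart meets the closure of the
  point in a closed torus orbit).
-/

noncomputable section

set_option linter.dupNamespace false -- mandated namespace of this single-conjunct summit

open CategoryTheory AlgebraicGeometry TopologicalSpace IsLocalRing
open Literature.AlgebraicGeometry.Resolution
open Summit.ResolutionOfSingularities.ResolutionOfSingularities.Theorems

namespace Summit.ResolutionOfSingularities.ResolutionOfSingularities.Theorems.ELadderOne

/-! ## Stages of an e = 1 sequence -/

/-- **A STAGE of an e = 1 admissible sequence**: the cobordant tower's presentation data (hypersurface pair
`(Y, ker i)` over `k`, torus-quotient presentation `q : X ⟶ V`, graded atlas of rank `j` = torus charts with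
finite stabilisers).  Object of the e-ladder line of the door; EVIDENCE, not a claim. [folklore] -/
structure Stage (k : Type) [Field k] : Type 1 where
  /-- ambient -/
  Y : Scheme.{0}
  /-- structure morphism -/
  f : Y ⟶ Spec (.of k)
  [smooth : Smooth f]
  [isSeparated : IsSeparated f]
  [quasiCompact : QuasiCompact f]
  /-- the hypersurface, as a closed immersion from an integral scheme -/
  X : Scheme.{0}
  /-- its embedding -/
  i : X ⟶ Y
  [isClosedImmersion : IsClosedImmersion i]
  [isIntegral : IsIntegral X]
  /-- `ker i` is locally principal -/
  isLocallyPrincipal : IsLocallyPrincipal i.ker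
  /-- the torus quotient of the hypersurface -/
  V : Scheme.{0}
  /-- the quotient map -/
  q : X ⟶ V
  /-- structure morphism of the quotient -/
  g : V ⟶ Spec (.of k)
  [isIntegralV : IsIntegral V]
  [isSeparatedV : IsSeparated g]
  [locallyOfFiniteTypeV : LocallyOfFiniteType g]
  [quasiCompactV : QuasiCompact g]
  /-- `q` is a `k`-morphism -/
  hq : q ≫ g = i ≫ f
  /-- torus rank (= number of blow-ups so far) -/
  j : ℕ
  /-- the graded atlas (torus charts with finite stabilisers) -/
  atlas : GradedAtlas j f i q

namespace Stage

variable {k : Type} [Field k]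

/-- structure field as an instance [folklore] -/
instance (S : Stage k) : Smooth S.f := S.smooth
/-- structure field as an instance [folklore] -/
instance (S : Stage k) : IsSeparated S.f := S.isSeparated
/-- structure field as an instance [folklore] -/
instance (S : Stage k) : QuasiCompact S.f := S.quasiCompact
/-- structure field as an instance [folklore] -/
instance (S : Stage k) : IsClosedImmersion S.i := S.isClosedImmersion
/-- structure field as an instance [folklore] -/
instance (S : Stage k) : IsIntegral S.X := S.isIntegral
/-- structure field as an instance [folklore] -/
instance (S : Stage k) : IsIntegral S.V := S.isIntegralV
/-- structure field as an instance [folklore] -/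
instance (S : Stage k) : IsSeparated S.g := S.isSeparatedV
/-- structure field as an instance [folklore] -/
instance (S : Stage k) : LocallyOfFiniteType S.g := S.locallyOfFiniteTypeV
/-- structure field as an instance [folklore] -/
instance (S : Stage k) : QuasiCompact S.g := S.quasiCompactV

/-- The underlying hypersurface pair `(Y, ker i)`. [folklore] -/
def toPair (S : Stage k) : HypersurfacePair k := HypersurfacePair.ofKer S.f S.i S.isLocallyPrincipal

/-- The MAXIMAL POINTS of the image of the non-regular locus (generic points of its irreducible components:
no proper generisation inside `singImage`). [folklore] -/
def maxSing (S : Stage k) : Set S.Y :=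
  {η | η ∈ singImage S.i.ker ∧ ∀ y ∈ singImage S.i.ker, η ∈ closure ({y} : Set S.Y) → y = η}

/-- The termination measure of rung 1: the largest order of the hypersurface at a maximal point of `singImage`. [folklore] -/
def mu (S : Stage k) : ℕ∞ := ⨆ η ∈ S.maxSing, idealOrder S.i.ker η

/-- **The invariant of rung 1.** (I1) at every maximal point of `singImage` the ambient local ring is regular of
dimension `2`; (I2) on every chart of the atlas through such a point, its prime is homogeneous with
graded-simple quotient (the chart meets its closure in a closed orbit).  A predicate of the line. [folklore] -/
def Inv (S : Stage k) : Prop :=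
  (∀ η ∈ S.maxSing, IsRegularLocalRing (S.Y.presheaf.stalk η) ∧
      ringKrullDim (S.Y.presheaf.stalk η) = ((2 : ℕ) : WithBot ℕ∞)) ∧
  ∀ (a : S.atlas.ι) (η : S.Y) (_ : η ∈ S.maxSing) (hη : η ∈ (S.atlas.W a : S.Y.Opens)),
    letI := S.atlas.gradedRing a
    (((S.atlas.W a).2.primeIdealOf ⟨η, hη⟩).asIdeal).IsHomogeneous (S.atlas.piece a) ∧
    ∀ (d : Fin S.j → ℤ) (x : Γ(S.Y, S.atlas.W a)), x ∈ S.atlas.piece a d →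
      x ∉ ((S.atlas.W a).2.primeIdealOf ⟨η, hη⟩).asIdeal →
        IsUnit (Ideal.Quotient.mk ((S.atlas.W a).2.primeIdealOf ⟨η, hη⟩).asIdeal x)

end Stage

end Summit.ResolutionOfSingularities.ResolutionOfSingularities.Theorems.ELadderOne

end
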